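import Summits.AnomalousDissipation.AnomalousDissipation.Theorems.TaylorCertificatePair.Negative.Ceiling

/-!
# Refutation of `TaylorCertificates.TaylorCertificatePair` (stmt-AnomalousDissipation-13037)

`TaylorCertificatePair` (route `AnomalousDissipation/TaylorCertificates`, crux, rank 2) asks for ONE smooth
divergence-free mean-zero force `f` on `T³` and `ν`-INDEPENDENT constants `ε₀, E, C, Θ, ν₀` such that for
every `ν ∈ (0, ν₀)` there are Taylor-resolved cylindrical test functionals `Φ₁, Φ₂` (test fields of Fourier
degree `≤ N ≤ C ν^{-1/2}`) and energy weights `-Θ ≤ θᵢ ≤ 0` whose FLOOR/CEILING inequalities hold at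
every finite-enstrophy state `u ∈ H` of the Leray ball `‖u‖² ≤ 16‖f‖₂²/ν²`.

## The witness (CEILING killed by an unresolved beat; classification: refuted-substantive)

Write `F = ‖f‖₂ > 0` (`f = 0` is excluded by the FLOOR at rest, `ε₀ ≤ 0`). Fix `ν = s⁻⁴`, `s` large.
1. *Far shear state.* `uₑ = (F/ν)√2 cos(2πx₂) e₀ ∈ H` has `‖uₑ‖² = F²/ν²`, `ν‖∇uₑ‖² = 4π²F²/ν`,
   `(uₑ, f) = O(F²/ν)`, and no self-interaction. With `G := Φ₂'(uₑ)` (a band-limited, divergence-free,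
   mean-zero trigonometric polynomial of degree `≤ N`) and `𝔊² := ∑_{|k|≤N} ‖Ĝ(k)‖²`, the CEILING at
   `uₑ` reads `F²/ν² − E ≤ c₁ F 𝔊 + (2√2 + 8π²) Θ F²/ν` (`c₁ = 1 + 4π²√2`): the multiplier is large,
   `𝔊 ≳ F s⁸`.
2. *Beat state.* Let `q` maximise `‖Ĝ(k)‖` over the ball (`‖Ĝ(q)‖² #ball ≥ 𝔊²`, `q ≠ 0` since `Ĝ(0)=0`).
   In the integer frame `rₐ ⊥ q`, `r_b = q × rₐ` of `q^⊥` one of the two directions (Gram identity)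
   gives a real unit `B̂ ⊥ r, q` with `2|⟪Ĝ(q), B̂⟫|² ≥ ‖Ĝ(q)‖²`. Take `p = t r` with `|p| ≥ 2N + 4`
   (`|p|, |p+q| ≤ N² + 2N + 5`) and the waves `Re(e_p ⊗ αq̂)`, `Re(e_{p+q} ⊗ ωαB̂)`, `α = F/(2ν)`,
   `ω = -i ζ̄/|ζ|`. They are invisible to the test fields, so `Φ₂'(u_w) = G`; by the PAIR FORMULA
   (`pair_formula`: the inertial term of two modes against `G` in Fourier variables) all interactions
   vanish except the `(p, p+q)` beat at `q`, worth `−π α² |q| |ζ| ≤ −(π/(4√2)) F² s⁸ 𝔊/√#ball`.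
3. The CEILING at `u_w` (left side `≥ −E`) then bounds this gain by the viscous price of the waves through
   the energy channel, `O(Θ F² (N²+2N+5)² s⁴) = O(s¹²)`, plus `c₁F𝔊`; since the gain is `≳ s¹³`
   (`#ball ≤ (2N+1)³ ≤ (2C+1)³ s⁶`), `s ≥ S₀(F, E, C, Θ)` is contradictory (`endgame`).
No cheap repair: the same witness kills every resolution `N ≤ Cν^{-α}`, `α < 6/11` (with a finer lattice
`α < 6/7`); the repairs it misses (`|θ₂| ≤ Θ/ν`, or `N ≳ ν⁻¹`) are the route's declared pivot, i.e. a
different bet. Barrier-candidate: "ν-uniform energy weights cannot price unresolved beats against a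
resolved multiplier forced to size ν⁻² by far laminar states".

All space integrals are computed in Fourier variables over the tree's `Torus.realTrigPoly` API; the states
are finite sums of single real modes (`exists_state`), the differential of a band-limited cylindrical
functional is handled through its Fourier coefficients (`fc_grad_eq_zero`, `dotc_fc_grad`, `fc_grad_zero`).
Support: `Theorems/TaylorCertificatePair/Negative/{Modes, ModesFourier, Frame, Bounds, Endgame, Ceiling}.lean`.
Refuter seat `refuter-cdisprove-stmt-AnomalousDissipation-13037-0`, 2026-08-15/16.
-/

noncomputable section

namespace Summit.AnomalousDissipation.AnomalousDissipation.Theses.TaylorCertificates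

open scoped BigOperators Topology Manifold Classical MeasureTheory ProbabilityTheory Matrix InnerProductSpace ComplexConjugate ContinuousMap
open Filter Set Function TopologicalSpace MeasureTheory

/-- **Record of the replaced/dropped route item `TaylorCertificatePair`** = stmt-AnomalousDissipation-13037 (ledger signature verbatim, in
the route file's namespace and `open` context; NOT a route item): after `TaylorCertificatesTaylorCertificatePair_refuted` (below) closed the
item `refuted`, the route repair (`restate` under a new name, or `drop`) removed
this constant from the gate-written Theses file, while the Theorems file below — append-only,
statement text fixed — still names it ("Unknown identifier" in the full builds of 2026-08-16).
Re-declared here under its original fully-qualified name and definiens solely so that this record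
keeps elaborating. FALSE (refuted below). -/
def TaylorCertificatePair : Prop :=
  ∃ f : UnitAddTorus (Fin 3) → EuclideanSpace ℝ (Fin 3), Literature.Analysis.FunctionSpaces.Torus.IsSmooth f ∧ Literature.Analysis.FunctionSpaces.Torus.IsDivFree f ∧ Literature.Analysis.FunctionSpaces.Torus.HasZeroMean f ∧ ∃ (ε₀ E C Θ ν₀ : ℝ), 0 < ε₀ ∧ 0 < ν₀ ∧ ∀ ν : ℝ, 0 < ν → ν < ν₀ → ∃ (N : ℕ) (Φ₁ Φ₂ : Literature.Analysis.FluidPDE.Torus.CylindricalTest (Fin 3)) (θ₁ θ₂ : ℝ), (N : ℝ) ≤ C * ν ^ (-(1 / 2 : ℝ)) ∧ (∀ i, Literature.Analysis.FunctionSpaces.Torus.fourierTruncate N (Φ₁.g i) = Φ₁.g i) ∧ (∀ i, Literature.Analysis.FunctionSpaces.Torus.fourierTruncate N (Φ₂.g i) = Φ₂.g i) ∧ -Θ ≤ θ₁ ∧ θ₁ ≤ 0 ∧ -Θ ≤ θ₂ ∧ θ₂ ≤ 0 ∧ ∀ u : Literature.Analysis.FunctionSpaces.Torus.energySpace (Fin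 3), let uf : UnitAddTorus (Fin 3) → EuclideanSpace ℝ (Fin 3) := ((u : MeasureTheory.Lp (EuclideanSpace ℝ (Fin 3)) 2 (MeasureTheory.volume : MeasureTheory.Measure (UnitAddTorus (Fin 3)))) : UnitAddTorus (Fin 3) → EuclideanSpace ℝ (Fin 3)); let D : ℝ := ν * (Literature.Analysis.FunctionSpaces.Torus.eGradNormSq uf).toReal; let P : ℝ := Literature.Analysis.FluidPDE.Torus.pairing (u : MeasureTheory.Lp (EuclideanSpace ℝ (Fin 3)) 2 (MeasureTheory.volume : MeasureTheory.Measure (UnitAddTorus (Fin 3)))) f - D; Literature.Analysis.FunctionSpaces.Torus.eGradNormSq uf ≠ ⊤ → ‖u‖ ^ 2 ≤ 16 * (∫ x, ‖f x‖ ^ 2) / ν ^ 2 → ε₀ ≤ D + Literature.Analysis.FluidPDE.Torus.nsGeneratorPairing ν f u (Φ₁.grad u) + 2 * θ₁ * P ∧ ‖u‖ ^ 2 - E ≤ Literature.Analysis.FluidPDE.Torus.nsGeneratorPairing ν f u (Φ₂.grad u) + 2 * θ₂ * P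

end Summit.AnomalousDissipation.AnomalousDissipation.Theses.TaylorCertificates

open MeasureTheory UnitAddTorus Matrix
open scoped InnerProductSpace ENNReal ComplexConjugate

namespace Summit.AnomalousDissipation.AnomalousDissipation.Theorems.TaylorCertificatePair.Negative

open Literature.Analysis.FunctionSpaces Literature.Analysis.FluidPDE

/-- Refutes `TaylorCertificates.TaylorCertificatePair` [refuted-substantive]: for EVERY smooth
divergence-free mean-zero force `f`, no `ν`-uniform family of Taylor-resolved (`N ≤ Cν^{-1/2}`)
cylindrical CEILING certificates with `ν`-uniform energy weights `-Θ ≤ θ₂ ≤ 0` exists on the Leray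
ball. Witness: at the far laminar shear state `uₑ = (F/ν)√2 cos(2πx₂)e₀` (`F = ‖f‖₂`) the CEILING
forces the resolved multiplier `Φ₂'(uₑ)` to have `ℓ²` size `≳ ν⁻²`; two unresolved plane waves at
`p ⊥ q` and `p + q` (`|p| > N`, invisible to the test fields, so `Φ₂'` is unchanged) beating at the
largest resolved coefficient `q` of `Φ₂'(uₑ)` then lower the generator pairing by `≳ ν^{-13/4}`
while their viscous price through the energy channel is only `O(ν⁻³)`; for `ν = s⁻⁴` with
`s ≥ S₀(‖f‖₂, E, C, Θ)` this contradicts the CEILING at the beat state (`f = 0` is excluded by the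
FLOOR at rest). No cheap repair: the same witness kills every resolution `N ≤ Cν^{-α}` with
`α < 6/11` (and, with a finer lattice choice, `α < 6/7`); the surviving repairs (`|θ₂| ≤ Θ/ν`, or
`N ≳ ν⁻¹`) are different bets (the route's declared pivot). [folklore] -/
theorem _root_.Summit.AnomalousDissipation.AnomalousDissipation.Theorems.TaylorCertificatesTaylorCertificatePair_refuted :
    ¬ Summit.AnomalousDissipation.AnomalousDissipation.Theses.TaylorCertificates.TaylorCertificatePair := by
  rintro ⟨f, hfs, -, -, ε₀, E, C, Θ, ν₀, hε₀, hν₀, hcert⟩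
  have hF2nn : 0 ≤ ∫ x, ‖f x‖ ^ 2 := integral_nonneg fun x => by positivity
  by_cases hF0 : ∫ x, ‖f x‖ ^ 2 = 0
  · /- Step 0: a vanishing force is excluded by the FLOOR at rest. -/
    obtain ⟨N, Φ₁, Φ₂, θ₁, θ₂, -, -, -, -, -, -, -, hu⟩ :=
      hcert (ν₀ / 2) (by positivity) (by linarith)
    have hu0 := hu (0 : (Torus.energySpace (Fin 3)))
    dsimp only at hu0
    have h1 : Torus.eGradNormSq (((0 : (Torus.energySpace (Fin 3))) : (Lp (EuclideanSpace ℝ (Fin 3)) 2 (volume : Measure (UnitAddTorus (Fin 3))))) : (UnitAddTorus (Fin 3)) → (EuclideanSpace ℝ (Fin 3))) ≠ ⊤ := by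
      rw [eGradNormSq_coe_zero]; exact ENNReal.zero_ne_top
    have h2 : ‖(0 : (Torus.energySpace (Fin 3)))‖ ^ 2 ≤ 16 * (∫ x, ‖f x‖ ^ 2) / (ν₀ / 2) ^ 2 := by
      rw [norm_zero, hF0]; norm_num
    have hfl := (hu0 h1 h2).1
    have hzero := certificate_terms_at_zero (ae_zero_of_integral_sq_zero hfs hF0) (ν₀ / 2) θ₁ (Φ₁.grad 0)
    linarith
  /- Step 1: constants and the viscosity. -/
  have hF2pos : 0 < ∫ x, ‖f x‖ ^ 2 := lt_of_le_of_ne hF2nn (Ne.symm hF0)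
  obtain ⟨F, hFdef⟩ : ∃ F : ℝ, F = Real.sqrt (∫ x, ‖f x‖ ^ 2) := ⟨_, rfl⟩
  have hF : 0 < F := by rw [hFdef]; exact Real.sqrt_pos.2 hF2pos
  have hFsq : F ^ 2 = ∫ x, ‖f x‖ ^ 2 := by rw [hFdef]; exact Real.sq_sqrt hF2nn
  obtain ⟨C', hC'⟩ : ∃ C' : ℝ, C' = max C 0 := ⟨_, rfl⟩
  obtain ⟨Θ', hΘ'⟩ : ∃ Θ' : ℝ, Θ' = max Θ 0 := ⟨_, rfl⟩
  have hC'0 : 0 ≤ C' := by rw [hC']; exact le_max_right _ _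
  have hΘ'0 : 0 ≤ Θ' := by rw [hΘ']; exact le_max_right _ _
  obtain ⟨s, hsdef⟩ : ∃ s : ℝ, s = (2 + 2 * (1 + 4 * Real.pi ^ 2 * Real.sqrt 2) * (F) / (Real.pi / (4 * Real.sqrt 2) * ((F)) ^ 2 / (Real.sqrt ((2 * (((C'))) + 1) ^ 3))) + 2 * (|E| + (2 * Real.sqrt 2 + 8 * Real.pi ^ 2) * (Θ') * (F) ^ 2) / (F) ^ 2 + 4 * (1 + 4 * Real.pi ^ 2 * Real.sqrt 2) * (|(E)| + 6 * ((Θ')) * ((F)) ^ 2 + 72 * Real.pi ^ 2 * ((Θ')) * (((((C'))) ^ 2 + 2 * (((C'))) + 5)) ^ 2 * ((F)) ^ 2) / ((Real.pi / (4 * Real.sqrt 2) * ((F)) ^ 2 / (Real.sqrt ((2 * (((C'))) + 1) ^ 3))) * (F))) + 1 / ν₀ + 1 := ⟨_, rfl⟩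
  have hS2 : (2 : ℝ) ≤ (2 + 2 * (1 + 4 * Real.pi ^ 2 * Real.sqrt 2) * (F) / (Real.pi / (4 * Real.sqrt 2) * ((F)) ^ 2 / (Real.sqrt ((2 * (((C'))) + 1) ^ 3))) + 2 * (|E| + (2 * Real.sqrt 2 + 8 * Real.pi ^ 2) * (Θ') * (F) ^ 2) / (F) ^ 2 + 4 * (1 + 4 * Real.pi ^ 2 * Real.sqrt 2) * (|(E)| + 6 * ((Θ')) * ((F)) ^ 2 + 72 * Real.pi ^ 2 * ((Θ')) * (((((C'))) ^ 2 + 2 * (((C'))) + 5)) ^ 2 * ((F)) ^ 2) / ((Real.pi / (4 * Real.sqrt 2) * ((F)) ^ 2 / (Real.sqrt ((2 * (((C'))) + 1) ^ 3))) * (F))) := two_le_S₀ (E := E) hF hC'0 hΘ'0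
  have hν₀inv : 0 ≤ 1 / ν₀ := by positivity
  have hsS : (2 + 2 * (1 + 4 * Real.pi ^ 2 * Real.sqrt 2) * (F) / (Real.pi / (4 * Real.sqrt 2) * ((F)) ^ 2 / (Real.sqrt ((2 * (((C'))) + 1) ^ 3))) + 2 * (|E| + (2 * Real.sqrt 2 + 8 * Real.pi ^ 2) * (Θ') * (F) ^ 2) / (F) ^ 2 + 4 * (1 + 4 * Real.pi ^ 2 * Real.sqrt 2) * (|(E)| + 6 * ((Θ')) * ((F)) ^ 2 + 72 * Real.pi ^ 2 * ((Θ')) * (((((C'))) ^ 2 + 2 * (((C'))) + 5)) ^ 2 * ((F)) ^ 2) / ((Real.pi / (4 * Real.sqrt 2) * ((F)) ^ 2 / (Real.sqrt ((2 * (((C'))) + 1) ^ 3))) * (F))) ≤ s := by rw [hsdef]; linarith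
  have hs2 : 2 ≤ s := hS2.trans hsS
  have hs1 : 1 ≤ s := by linarith
  have hs0 : 0 < s := by linarith
  have hs4pos : 0 < s ^ 4 := by positivity
  obtain ⟨ν, hνdef⟩ : ∃ ν : ℝ, ν = (s ^ 4)⁻¹ := ⟨_, rfl⟩
  have hν : 0 < ν := by rw [hνdef]; exact inv_pos.2 hs4pos
  have hνν₀ : ν < ν₀ := by
    have hs14 : s ≤ s ^ 4 := by
      calc s = s ^ 1 := (pow_one s).symm
        _ ≤ s ^ 4 := pow_le_pow_right₀ hs1 (by norm_num)
    have h1 : 1 / ν₀ < s := by rw [hsdef]; linarith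
    rw [hνdef, inv_lt_comm₀ hs4pos hν₀]
    calc ν₀⁻¹ = 1 / ν₀ := (one_div ν₀).symm
      _ < s := h1
      _ ≤ s ^ 4 := hs14
  have hν1 : 1 / ν = s ^ 4 := by rw [one_div, hνdef, inv_inv]
  have hν2 : 1 / ν ^ 2 = s ^ 8 := by
    rw [one_div, hνdef, inv_pow, inv_inv]; ring
  obtain ⟨N, Φ₁, Φ₂, θ₁, θ₂, hN, -, hT₂, -, -, hθ₂, hθ₂', hu⟩ := hcert ν hν hνν₀
  have hΘ : 0 ≤ Θ := by linarith
  have hΘeq : Θ' = Θ := by rw [hΘ']; exact max_eq_left hΘ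
  -- the resolution in terms of `s`
  have hNs : (N : ℝ) ≤ C' * s ^ 2 := by
    rw [hνdef, rpow_neg_half_inv_pow_four hs0] at hN
    refine hN.trans (mul_le_mul_of_nonneg_right ?_ (by positivity))
    rw [hC']; exact le_max_left _ _
  have hN0 : (0 : ℝ) ≤ N := Nat.cast_nonneg N
  /- Step 2: the far shear state and the CEILING there. -/
  obtain ⟨ue, hue⟩ := exists_state ![(![0, 1, 0] : Fin 3 → ℤ)] ![((((F) / (ν) * Real.sqrt 2 : ℝ) : ℂ) • (EuclideanSpace.complexify (EuclideanSpace.single (0 : Fin 3) (1 : ℝ)) : EuclideanSpace ℂ (Fin 3)))] one_ne_zero' (one_dotc F ν)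
  have hue1 : Torus.eGradNormSq (((ue : (Torus.energySpace (Fin 3))) : (Lp (EuclideanSpace ℝ (Fin 3)) 2 (volume : Measure (UnitAddTorus (Fin 3))))) : (UnitAddTorus (Fin 3)) → (EuclideanSpace ℝ (Fin 3))) ≠ ⊤ := by
    rw [eGradNormSq_congr_ae' hue]; exact eGradNormSq_modes_ne_top
  have hue2 : ‖ue‖ ^ 2 ≤ 16 * (∫ x, ‖f x‖ ^ 2) / ν ^ 2 := by
    rw [norm_sq_of_ae hue, integral_norm_sq_modes_shear hF.le hν, ← hFsq]
    have : 0 ≤ F ^ 2 / ν ^ 2 := by positivity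
    rw [mul_div_assoc]
    linarith
  have hue' := hu ue
  dsimp only at hue'
  have hceil_e := (hue' hue1 hue2).2
  have hI0 := ceil_shear hfs hν hF hFdef.symm Φ₂ hT₂ hθ₂ hθ₂' ue hue hceil_e
  obtain ⟨G, hGdef⟩ : ∃ G : (UnitAddTorus (Fin 3)) → (EuclideanSpace ℝ (Fin 3)), G = Φ₂.grad ue := ⟨_, rfl⟩
  obtain ⟨𝔊, h𝔊def⟩ : ∃ 𝔊 : ℝ, 𝔊 = (Real.sqrt (∑ κ' ∈ Torus.freqBall N, ‖mFourierCoeff (EuclideanSpace.complexify ∘ G) κ'‖ ^ 2)) := ⟨_, rfl⟩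
  rw [← hGdef, ← h𝔊def] at hI0
  have h𝔊0 : 0 ≤ 𝔊 := by rw [h𝔊def]; exact coeffNorm_nonneg N G
  have hI : F ^ 2 * s ^ 8 - E - (2 * Real.sqrt 2 + 8 * Real.pi ^ 2) * Θ * F ^ 2 * s ^ 4 ≤ (1 + 4 * Real.pi ^ 2 * Real.sqrt 2) * F * 𝔊 := by
    have e1 : F ^ 2 / ν ^ 2 = F ^ 2 * s ^ 8 := by rw [div_eq_mul_one_div, hν2]
    have e2' : (2 * Real.sqrt 2 + 8 * Real.pi ^ 2) * Θ * F ^ 2 / ν =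
        (2 * Real.sqrt 2 + 8 * Real.pi ^ 2) * Θ * F ^ 2 * s ^ 4 := by rw [div_eq_mul_one_div, hν1]
    rw [e1, e2'] at hI0
    linarith
  have hIΘ : F ^ 2 * s ^ 8 - E - (2 * Real.sqrt 2 + 8 * Real.pi ^ 2) * Θ' * F ^ 2 * s ^ 4 ≤ (1 + 4 * Real.pi ^ 2 * Real.sqrt 2) * F * 𝔊 := by
    rwa [hΘeq]
  -- the multiplier is large, hence nonzero
  have hmult := multiplier_large hF hΘ'0 hC'0 hsS hIΘ
  have h𝔊pos : 0 < 𝔊 := by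
    have h1 : 0 < F ^ 2 * s ^ 8 := by positivity
    have hc := c₁_pos
    by_contra hneg
    have h' : 𝔊 ≤ 0 := not_lt.1 hneg
    have h2 : 0 ≤ 2 * (1 + 4 * Real.pi ^ 2 * Real.sqrt 2) * F := by positivity
    have h3 : 2 * (1 + 4 * Real.pi ^ 2 * Real.sqrt 2) * F * 𝔊 ≤ 0 := mul_nonpos_of_nonneg_of_nonpos h2 h'
    linarith
  /- Step 3: the largest resolved coefficient `q`. -/
  obtain ⟨q, hqmem, hqmax⟩ := Finset.exists_max_image (Torus.freqBall (d := Fin 3) N)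
    (fun κ => ‖(mFourierCoeff (EuclideanSpace.complexify ∘ G) κ)‖) ⟨0, Torus.zero_mem_freqBall N⟩
  have hcardq : 𝔊 ^ 2 ≤ (Torus.freqBall (d := Fin 3) N).card * ‖(mFourierCoeff (EuclideanSpace.complexify ∘ G) q)‖ ^ 2 := by
    rw [h𝔊def]; exact coeffNorm_sq_le_card_mul hqmax
  obtain ⟨g, hgdef⟩ : ∃ g : (EuclideanSpace ℂ (Fin 3)), g = (mFourierCoeff (EuclideanSpace.complexify ∘ G) q) := ⟨_, rfl⟩
  rw [← hgdef] at hcardq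
  have hg0 : g ≠ 0 := by
    intro h
    rw [h, norm_zero] at hcardq
    have h2 : 0 < 𝔊 ^ 2 := by positivity
    have h3 : 𝔊 ^ 2 ≤ 0 := by simpa using hcardq
    linarith
  have hq0 : q ≠ 0 := by
    rintro rfl
    apply hg0
    rw [hgdef, hGdef]
    exact fc_grad_zero Φ₂ _
  have hfqN : Torus.freqNormSq q ≤ (N : ℝ) ^ 2 := Torus.mem_freqBall.1 hqmem
  have hfq1 : 1 ≤ Torus.freqNormSq q := Torus.one_le_freqNormSq_of_ne_zero hq0
  /- Step 4: the frame and the polarisation direction. -/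
  have hgt : ((fun j => ((q) j : ℂ)) ⬝ᵥ (WithLp.ofLp (g))) = 0 := by rw [hgdef, hGdef]; exact dotc_fc_grad Φ₂ _ q
  obtain ⟨r, B, hr0, hrq, hrq2, hB1, hrB, hqB, hgB⟩ := frame_selection hq0 g hgt
  obtain ⟨ζ, hζdef⟩ : ∃ ζ : ℂ, ζ = ⟪g, EuclideanSpace.complexify B⟫_ℂ := ⟨_, rfl⟩
  rw [← hζdef] at hgB
  have hζ0 : ζ ≠ 0 := by
    intro h
    rw [h, norm_zero] at hgB
    have h2 : ‖g‖ ^ 2 ≤ 0 := by simpa using hgB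
    have h3 : ‖g‖ ^ 2 = 0 := le_antisymm h2 (sq_nonneg _)
    exact hg0 (norm_eq_zero.1 (pow_eq_zero_iff two_ne_zero |>.1 h3))
  /- Step 5: the unresolved wave frequencies. -/
  obtain ⟨t, p, hpdef, hpq, hNp, hNpq, hN1, hN2, hN3, hN4, hN5, hLp, hLpq⟩ :=
    wave_frequencies N hfqN hr0 hrq hrq2
  have hp0 : p ≠ 0 := ne_zero_of_freqNormSq_pos (sq_nonneg _) hNp
  have hpq0 : p + q ≠ 0 := ne_zero_of_freqNormSq_pos (sq_nonneg _) hNpq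
  /- Step 6: the polarisations. -/
  obtain ⟨α, hαdef⟩ : ∃ α : ℝ, α = F / (2 * ν) := ⟨_, rfl⟩
  have hα0 : 0 ≤ α := by rw [hαdef]; exact div_nonneg hF.le (by positivity)
  have hzA : ‖((((α) / Real.sqrt (Torus.freqNormSq (q)) : ℝ) : ℂ) • EuclideanSpace.complexify (WithLp.toLp 2 (fun i => ((q) i : ℝ))))‖ ≤ F / (2 * ν) := by rw [norm_polA hα0 hq0, hαdef]
  have hzB : ‖(((-Complex.I * conj ((ζ)) * ((‖(ζ)‖⁻¹ : ℝ) : ℂ)) * ((α) : ℂ)) • EuclideanSpace.complexify (B))‖ ≤ F / (2 * ν) := by rw [norm_polB α hα0 hζ0 hB1, hαdef]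
  have hdA : ((fun j => ((p) j : ℂ)) ⬝ᵥ (WithLp.ofLp ((((((α) / Real.sqrt (Torus.freqNormSq (q)) : ℝ) : ℂ) • EuclideanSpace.complexify (WithLp.toLp 2 (fun i => ((q) i : ℝ)))))))) = 0 := by
    rw [dotc_polA, hpq]; simp
  have hdB : ((fun j => (((p + q)) j : ℂ)) ⬝ᵥ (WithLp.ofLp (((((-Complex.I * conj ((ζ)) * ((‖(ζ)‖⁻¹ : ℝ) : ℂ)) * ((α) : ℂ)) • EuclideanSpace.complexify (B)))))) = 0 := by
    rw [dotc_polB]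
    have hsum : (∑ j, ((p + q) j : ℝ) * B j) = 0 := by
      have e : ∀ j, ((p + q) j : ℝ) * B j = (t : ℝ) * ((r j : ℝ) * B j) + (q j : ℝ) * B j := by
        intro j
        rw [hpdef]
        simp only [Pi.add_apply, Int.cast_add, Int.cast_mul, Int.cast_natCast]
        ring
      simp_rw [e, Finset.sum_add_distrib, ← Finset.mul_sum, hrB, hqB]
      ring
    rw [hsum]; simp
  obtain ⟨uw, huw⟩ := exists_state ![(![0, 1, 0] : Fin 3 → ℤ), p, p + q] ![((((F) / (ν) * Real.sqrt 2 : ℝ) : ℂ) • (EuclideanSpace.complexify (EuclideanSpace.single (0 : Fin 3) (1 : ℝ)) : EuclideanSpace ℂ (Fin 3))), ((((α) / Real.sqrt (Torus.freqNormSq (q)) : ℝ) : ℂ) • EuclideanSpace.complexify (WithLp.toLp 2 (fun i => ((q) i : ℝ)))), (((-Complex.I * conj ((ζ)) * ((‖(ζ)‖⁻¹ : ℝ) : ℂ)) * ((α) : ℂ)) • EuclideanSpace.complexify (B))]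
    (three_ne_zero hp0 hpq0) (three_dotc (F := F) (ν := ν) hdA hdB)
  -- transversality of the multiplier at `-q` makes the `(p', p)` interaction vanish
  have hAq : ⟪(mFourierCoeff (EuclideanSpace.complexify ∘ (Φ₂.grad ue)) (-q)), ((((α) / Real.sqrt (Torus.freqNormSq (q)) : ℝ) : ℂ) • EuclideanSpace.complexify (WithLp.toLp 2 (fun i => ((q) i : ℝ))))⟫_ℂ = 0 := by
    rw [inner_polA]
    have h := dotc_fc_grad Φ₂ ue (-q)
    rw [dotc_neg_left, neg_eq_zero] at h
    rw [h, map_zero, mul_zero]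
  -- the value of the beat
  have hbeat : Real.pi * (conj (((fun j => ((q) j : ℂ)) ⬝ᵥ (WithLp.ofLp ((((((α) / Real.sqrt (Torus.freqNormSq (q)) : ℝ) : ℂ) • EuclideanSpace.complexify (WithLp.toLp 2 (fun i => ((q) i : ℝ))))))))) *
      ⟪(mFourierCoeff (EuclideanSpace.complexify ∘ (Φ₂.grad ue)) q), (((-Complex.I * conj ((ζ)) * ((‖(ζ)‖⁻¹ : ℝ) : ℂ)) * ((α) : ℂ)) • EuclideanSpace.complexify (B))⟫_ℂ).im ≤
      -(Real.pi * α * α * Real.sqrt (Torus.freqNormSq q) * ‖ζ‖) := by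
    rw [← hGdef, ← hgdef, hζdef]
    exact (beat_value g hq0 α α B (hζdef ▸ hζ0)).le
  /- Step 7: the beat state and the CEILING there. -/
  have hL1 : (1 : ℝ) ≤ ((N ^ 2 + 2 * N + 5 : ℕ) : ℝ) ^ 2 := by
    have : (1 : ℝ) ≤ ((N ^ 2 + 2 * N + 5 : ℕ) : ℝ) := by exact_mod_cast (by omega : 1 ≤ N ^ 2 + 2 * N + 5)
    exact one_le_pow₀ this
  have hL := three_freq_le (p := p) (q := q) hL1 hLp hLpq
  have huw1 : Torus.eGradNormSq (((uw : (Torus.energySpace (Fin 3))) : (Lp (EuclideanSpace ℝ (Fin 3)) 2 (volume : Measure (UnitAddTorus (Fin 3))))) : (UnitAddTorus (Fin 3)) → (EuclideanSpace ℝ (Fin 3))) ≠ ⊤ := by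
    rw [eGradNormSq_congr_ae' huw]; exact eGradNormSq_modes_ne_top
  have huw2 : ‖uw‖ ^ 2 ≤ 16 * (∫ x, ‖f x‖ ^ 2) / ν ^ 2 := by
    rw [norm_sq_of_ae huw, ← hFsq]
    have hsum := sum_norm_three_le hF hν hzA hzB
    have hsum0 : 0 ≤ ∑ m, ‖(![((((F) / (ν) * Real.sqrt 2 : ℝ) : ℂ) • (EuclideanSpace.complexify (EuclideanSpace.single (0 : Fin 3) (1 : ℝ)) : EuclideanSpace ℂ (Fin 3))), ((((α) / Real.sqrt (Torus.freqNormSq (q)) : ℝ) : ℂ) • EuclideanSpace.complexify (WithLp.toLp 2 (fun i => ((q) i : ℝ)))), (((-Complex.I * conj ((ζ)) * ((‖(ζ)‖⁻¹ : ℝ) : ℂ)) * ((α) : ℂ)) • EuclideanSpace.complexify (B))] : Fin 3 → (EuclideanSpace ℂ (Fin 3))) m‖ :=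
      Finset.sum_nonneg fun m _ => norm_nonneg _
    have hx : 0 ≤ F ^ 2 / ν ^ 2 := by positivity
    calc ∫ x, ‖(∑ mm, Torus.realTrigPoly {![(![0, 1, 0] : Fin 3 → ℤ), p, p + q] mm} (fun _ => ![((((F) / (ν) * Real.sqrt 2 : ℝ) : ℂ) • (EuclideanSpace.complexify (EuclideanSpace.single (0 : Fin 3) (1 : ℝ)) : EuclideanSpace ℂ (Fin 3))), ((((α) / Real.sqrt (Torus.freqNormSq (q)) : ℝ) : ℂ) • EuclideanSpace.complexify (WithLp.toLp 2 (fun i => ((q) i : ℝ)))), (((-Complex.I * conj ((ζ)) * ((‖(ζ)‖⁻¹ : ℝ) : ℂ)) * ((α) : ℂ)) • EuclideanSpace.complexify (B))] mm)) x‖ ^ 2 ≤ (3 * F / ν) ^ 2 :=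
          integral_norm_sq_modes_le.trans (pow_le_pow_left₀ hsum0 hsum 2)
      _ = 9 * (F ^ 2 / ν ^ 2) := by ring
      _ ≤ 16 * (F ^ 2 / ν ^ 2) := by linarith
      _ = 16 * F ^ 2 / ν ^ 2 := by ring
  have huw' := hu uw
  dsimp only at huw'
  have hceil_w := (huw' huw1 huw2).2
  have hII0 := ceil_beat hfs hν hF hFdef.symm Φ₂ hT₂ hθ₂ hθ₂' ue hue uw huw hdA hdB hzA hzB hNp hNpq
    hN1 hN2 hN3 hN4 hN5 hL hAq hbeat hceil_w
  rw [← hGdef, ← h𝔊def] at hII0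
  /- Step 8: the gain in terms of `𝔊` and the endgame. -/
  obtain ⟨card, hcarddef⟩ : ∃ card : ℝ, card = ((Torus.freqBall (d := Fin 3) N).card : ℝ) := ⟨_, rfl⟩
  rw [← hcarddef] at hcardq
  have hcard1 : 1 ≤ card := by
    have : 1 ≤ (Torus.freqBall (d := Fin 3) N).card :=
      Finset.card_pos.2 ⟨0, Torus.zero_mem_freqBall N⟩
    rw [hcarddef]; exact_mod_cast this
  have hcard : card ≤ (2 * (N : ℝ) + 1) ^ 3 := by rw [hcarddef]; exact card_freqBall_le N
  have hαs : α = F * s ^ 4 / 2 := by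
    rw [hαdef, hνdef]
    field_simp
  have hgain : Real.pi / (4 * Real.sqrt 2) * F ^ 2 * s ^ 8 * 𝔊 / Real.sqrt card ≤
      Real.pi * α * α * Real.sqrt (Torus.freqNormSq q) * ‖ζ‖ := by
    have := gain_lower (F := F) (s := s) h𝔊0 hcard1 hcardq (norm_nonneg g) hgB (norm_nonneg ζ) hfq1
    rw [hαs]
    exact this
  have hII : Real.pi / (4 * Real.sqrt 2) * F ^ 2 * s ^ 8 * 𝔊 / Real.sqrt card ≤
      E + (1 + 4 * Real.pi ^ 2 * Real.sqrt 2) * F * 𝔊 + 6 * Θ' * F ^ 2 * s ^ 4 +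
        72 * Real.pi ^ 2 * Θ' * ((N : ℝ) ^ 2 + 2 * N + 5) ^ 2 * F ^ 2 * s ^ 4 := by
    rw [hΘeq]
    have e1 : 6 * Θ * F ^ 2 / ν = 6 * Θ * F ^ 2 * s ^ 4 := by rw [div_eq_mul_one_div, hν1]
    have e2' : 72 * Real.pi ^ 2 * Θ * (((N ^ 2 + 2 * N + 5 : ℕ) : ℝ)) ^ 2 * F ^ 2 / ν =
        72 * Real.pi ^ 2 * Θ * ((N : ℝ) ^ 2 + 2 * N + 5) ^ 2 * F ^ 2 * s ^ 4 := by
      rw [div_eq_mul_one_div, hν1]; push_cast; ring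
    rw [e1, e2'] at hII0
    linarith
  exact endgame hF hΘ'0 hC'0 hsS hN0 hNs hcard1 hcard rfl h𝔊0 hIΘ hII

end Summit.AnomalousDissipation.AnomalousDissipation.Theorems.TaylorCertificatePair.Negative
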